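import Mathlib.NumberTheory.Chebyshev
import Mathlib.NumberTheory.AbelSummation
import Mathlib.Analysis.SpecialFunctions.Integrals.Basic
import Mathlib.Analysis.Complex.ExponentialBounds
import Literature.NumberTheory.LFunctions.GRHPrimeIdealCountLowerBound
import HarnessLib

/-!
# Chebyshev: `Σ_{p ≤ X} p^{-1/2} ≪ √X / log X`

Topic `Literature/NumberTheory/LFunctions`. Everything in this file is PROVED (no definitions, no
named facts).

The classical consequence of Chebyshev's bound `π(x) ≪ x/log x` obtained by partial summation:
`Σ_{p ≤ X} 1/√p ≤ 60 √X/log X` for `X ≥ 2`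
(`Literature.NumberTheory.LFunctions.sum_primes_inv_sqrt_le`). It is the estimate
"`Σ_{n ≤ u} Λ(n)/(√n log n) ≪ √u/log u`" used (for the primes) in M. Balazard–A. de Roton,
*Notes de lecture de l'article "Partial sums of the Möbius function" de K. Soundararajan*,
arXiv:0810.3587, proofs of Props. 16 and 18 (i). Ingredients: Mathlib's
`Chebyshev.pi_le_log4_mul_div` (through the tree's
`Literature.NumberTheory.LFunctions.NumberField.primeCounting_le_five_mul_div_log`) and Abel
summation `sum_mul_eq_sub_integral_mul₁`.

## References

* [BalazardDeRoton2008] M. Balazard, A. de Roton, arXiv:0810.3587, Props. 16, 18.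
  [cite: BalazardDeRoton2008, Prop. 16 (proof)]
* P. L. Chebyshev (1852); see Hardy–Wright, Thm. 7 and §22.
-/

noncomputable section

open Real Filter Set MeasureTheory intervalIntegral

namespace Literature.NumberTheory.LFunctions

namespace ChebyshevInvSqrt

/-- The prime-counting sum of the indicator: `Σ_{k ≤ n} 𝟙_{prime}(k) = π(n)`. [folklore] -/
theorem sum_indicator_prime_eq (n : ℕ) :
    ∑ k ∈ Finset.Icc 0 n, (if k.Prime then (1 : ℝ) else 0) = (Nat.primeCounting n : ℝ) := by
  rw [Finset.sum_boole, Nat.primeCounting_eq_primeCounting'_succ, ← Nat.primesBelow_card_eq_primeCounting']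
  congr 2
  ext k
  simp [Nat.primesBelow]

/-- `∫_a^b t^{-1/2} dt = 2(√b − √a)` (with Mathlib's conventions, for all real `a, b`). [folklore] -/
theorem integral_rpow_neg_half (a b : ℝ) :
    ∫ t in a..b, t ^ (-(1 / 2) : ℝ) = 2 * (Real.sqrt b - Real.sqrt a) := by
  rw [integral_rpow (Or.inl (by norm_num))]
  rw [show (-(1 / 2) : ℝ) + 1 = 1 / 2 by norm_num, ← Real.sqrt_eq_rpow, ← Real.sqrt_eq_rpow]
  field_simp

/-- `X^{1/4} ≤ 4 √X / log X` for `X > 1`, in the form `√(√X) · log X ≤ 4 √X`. [folklore] -/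
theorem sqrt_sqrt_mul_log_le {X : ℝ} (hX : 1 < X) : Real.sqrt (Real.sqrt X) * Real.log X ≤ 4 * Real.sqrt X := by
  have hX0 : 0 < X := by linarith
  set y := Real.sqrt (Real.sqrt X) with hy
  have hy0 : 0 < y := by positivity
  have hyX : Real.sqrt X = y * y := (Real.mul_self_sqrt (Real.sqrt_nonneg X)).symm
  have hlogX : Real.log X = 4 * Real.log y := by
    have h1 : Real.log (Real.sqrt X) = Real.log X / 2 := Real.log_sqrt hX0.le
    have h2 : Real.log y = Real.log (Real.sqrt X) / 2 := by rw [hy, Real.log_sqrt (Real.sqrt_nonneg X)]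
    linarith
  have hlogy : Real.log y ≤ y - 1 := Real.log_le_sub_one_of_pos hy0
  rw [hlogX, hyX]
  nlinarith

end ChebyshevInvSqrt

open ChebyshevInvSqrt in
/-- **Chebyshev by partial summation: `Σ_{p ≤ X} 1/√p ≤ 60 √X / log X` for `X ≥ 2`.**
[cite: BalazardDeRoton2008, Prop. 16 (proof)] -/
theorem sum_primes_inv_sqrt_le {X : ℝ} (hX : 2 ≤ X) :
    ∑ p ∈ (Finset.Ioc 0 ⌊X⌋₊).filter Nat.Prime, (1 / Real.sqrt p : ℝ) ≤ 60 * Real.sqrt X / Real.log X := by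
  have hX0 : 0 < X := by linarith
  have hX1 : 1 < X := by linarith
  have hlogX : 0 < Real.log X := Real.log_pos hX1
  have hsX : 0 < Real.sqrt X := Real.sqrt_pos.2 hX0
  -- Abel summation with `c = 𝟙_prime`, `f(u) = u^{-1/2}`
  set c : ℕ → ℝ := fun n ↦ if n.Prime then 1 else 0 with hc
  set f : ℝ → ℝ := fun u ↦ u ^ (-(1 / 2) : ℝ) with hf
  have hc0 : c 0 = 0 := by simp [hc, Nat.not_prime_zero]
  have hc1 : c 1 = 0 := by simp [hc, Nat.not_prime_one]
  have hfd : ∀ t ∈ Set.Icc 2 X, DifferentiableAt ℝ f t := fun t ht ↦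
    Real.differentiableAt_rpow_const_of_ne _ (by linarith [ht.1])
  have hderiv : ∀ t : ℝ, 0 < t → deriv f t = -(1 / 2) * t ^ (-(3 / 2) : ℝ) := by
    intro t ht
    rw [hf, (Real.hasDerivAt_rpow_const (Or.inl ht.ne')).deriv]
    norm_num
  have hderiv_cont : ContinuousOn (fun t : ℝ ↦ -(1 / 2) * t ^ (-(3 / 2) : ℝ)) (Set.Icc 2 X) := by
    refine ContinuousOn.mul continuousOn_const ?_
    exact ContinuousOn.rpow_const continuousOn_id fun t ht ↦ Or.inl (ne_of_gt (show (0 : ℝ) < t by linarith [ht.1]))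
  have hfi : IntegrableOn (deriv f) (Set.Icc 2 X) := by
    refine (hderiv_cont.integrableOn_Icc).congr_fun (fun t ht ↦ (hderiv t (by linarith [ht.1])).symm)
      measurableSet_Icc
  have habel := sum_mul_eq_sub_integral_mul₁ c hc0 hc1 X hfd hfi
  -- identify the pieces
  have hsumc : ∀ t : ℝ, ∑ k ∈ Finset.Icc 0 ⌊t⌋₊, c k = (Nat.primeCounting ⌊t⌋₊ : ℝ) := fun t ↦
    sum_indicator_prime_eq _
  have hLHS : ∑ k ∈ Finset.Icc 0 ⌊X⌋₊, f k * c k =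
      ∑ p ∈ (Finset.Ioc 0 ⌊X⌋₊).filter Nat.Prime, (1 / Real.sqrt p : ℝ) := by
    have h1 : ∑ k ∈ Finset.Icc 0 ⌊X⌋₊, f k * c k = ∑ k ∈ (Finset.Icc 0 ⌊X⌋₊).filter Nat.Prime, f k := by
      rw [Finset.sum_filter]
      refine Finset.sum_congr rfl fun k _ ↦ ?_
      by_cases hk : k.Prime <;> simp [hc, hk]
    have h2 : (Finset.Icc 0 ⌊X⌋₊).filter Nat.Prime = (Finset.Ioc 0 ⌊X⌋₊).filter Nat.Prime := by
      ext k
      simp only [Finset.mem_filter, Finset.mem_Icc, Finset.mem_Ioc, zero_le, true_and]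
      constructor
      · rintro ⟨h1, h2⟩; exact ⟨⟨h2.pos, h1⟩, h2⟩
      · rintro ⟨⟨_, h1⟩, h2⟩; exact ⟨h1, h2⟩
    rw [h1, h2]
    refine Finset.sum_congr rfl fun p hp ↦ ?_
    rw [Finset.mem_filter] at hp
    have hp0 : (0 : ℝ) ≤ p := by positivity
    rw [hf]
    beta_reduce
    rw [Real.rpow_neg hp0, ← Real.sqrt_eq_rpow, one_div]
  -- the boundary term
  have hbd : f X * ∑ k ∈ Finset.Icc 0 ⌊X⌋₊, c k ≤ 5 * Real.sqrt X / Real.log X := by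
    rw [hsumc, hf]
    beta_reduce
    rw [Real.rpow_neg hX0.le, ← Real.sqrt_eq_rpow]
    have := NumberField.primeCounting_le_five_mul_div_log hX
    calc (Real.sqrt X)⁻¹ * (Nat.primeCounting ⌊X⌋₊ : ℝ) ≤ (Real.sqrt X)⁻¹ * (5 * X / Real.log X) := by
          gcongr
      _ = 5 * Real.sqrt X / Real.log X := by
          have hXs : X = Real.sqrt X * Real.sqrt X := (Real.mul_self_sqrt hX0.le).symm
          field_simp
          nth_rewrite 1 [hXs]
          ring
  -- the integral term: `−∫ f' π ≤ (5/2) ∫_2^X t^{-1/2}/log t`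
  have hint_le : -(∫ t in Set.Ioc 2 X, deriv f t * ∑ k ∈ Finset.Icc 0 ⌊t⌋₊, c k) ≤
      ∫ t in Set.Ioc 2 X, (5 / 2) * (t ^ (-(1 / 2) : ℝ) / Real.log t) := by
    rw [← MeasureTheory.integral_neg]
    have hI1 : IntegrableOn (fun t ↦ deriv f t * ∑ k ∈ Finset.Icc 0 ⌊t⌋₊, c k) (Set.Ioc 2 X) :=
      (integrableOn_mul_sum_Icc c (by norm_num) hfi).mono_set Set.Ioc_subset_Icc_self
    have hcont2 : ContinuousOn (fun t : ℝ ↦ (5 / 2) * (t ^ (-(1 / 2) : ℝ) / Real.log t)) (Set.Icc 2 X) := by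
      refine ContinuousOn.mul continuousOn_const (ContinuousOn.div ?_ ?_ ?_)
      · exact ContinuousOn.rpow_const continuousOn_id fun t ht ↦ Or.inl (ne_of_gt (show (0 : ℝ) < t by linarith [ht.1]))
      · exact Real.continuousOn_log.mono fun t ht ↦ by simp only [Set.mem_compl_iff, Set.mem_singleton_iff]; linarith [ht.1]
      · intro t ht; exact (Real.log_pos (by linarith [ht.1])).ne'
    have hI2 : IntegrableOn (fun t : ℝ ↦ (5 / 2) * (t ^ (-(1 / 2) : ℝ) / Real.log t)) (Set.Ioc 2 X) :=
      hcont2.integrableOn_Icc.mono_set Set.Ioc_subset_Icc_self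
    refine setIntegral_mono_on hI1.neg hI2 measurableSet_Ioc fun t ht ↦ ?_
    have ht2 : 2 < t := ht.1
    have ht0 : 0 < t := by linarith
    have hlogt : 0 < Real.log t := Real.log_pos (by linarith)
    rw [hsumc, hderiv t ht0]
    have hπ := NumberField.primeCounting_le_five_mul_div_log ht2.le
    have h32 : t ^ (-(3 / 2) : ℝ) * t = t ^ (-(1 / 2) : ℝ) := by
      rw [show (-(1 / 2) : ℝ) = -(3 / 2) + 1 by norm_num, Real.rpow_add_one ht0.ne']
    have hpos : 0 ≤ t ^ (-(3 / 2) : ℝ) := Real.rpow_nonneg ht0.le _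
    calc -(-(1 / 2) * t ^ (-(3 / 2) : ℝ) * (Nat.primeCounting ⌊t⌋₊ : ℝ))
        = (1 / 2) * t ^ (-(3 / 2) : ℝ) * (Nat.primeCounting ⌊t⌋₊ : ℝ) := by ring
      _ ≤ (1 / 2) * t ^ (-(3 / 2) : ℝ) * (5 * t / Real.log t) := by gcongr
      _ = (5 / 2) * (t ^ (-(1 / 2) : ℝ) / Real.log t) := by rw [← h32]; field_simp
  -- bound `J = ∫_2^X t^{-1/2}/log t ≤ 22 √X / log X`
  have hJ : ∫ t in Set.Ioc 2 X, (5 / 2) * (t ^ (-(1 / 2) : ℝ) / Real.log t) ≤ (5 / 2) * (22 * Real.sqrt X / Real.log X) := by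
    rw [← intervalIntegral.integral_of_le hX, intervalIntegral.integral_const_mul]
    refine mul_le_mul_of_nonneg_left ?_ (by norm_num)
    set Y : ℝ := max 2 (Real.sqrt X) with hY
    have hY2 : 2 ≤ Y := le_max_left _ _
    have hYX : Y ≤ X := max_le hX (by
      rw [Real.sqrt_le_left hX0.le]; nlinarith)
    have hg_int : ∀ a b : ℝ, 2 ≤ a → a ≤ b → IntervalIntegrable (fun t : ℝ ↦ t ^ (-(1 / 2) : ℝ) / Real.log t) volume a b := by
      intro a b ha hab
      refine ContinuousOn.intervalIntegrable ?_
      rw [Set.uIcc_of_le hab]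
      refine ContinuousOn.div ?_ ?_ ?_
      · exact ContinuousOn.rpow_const continuousOn_id fun t ht ↦ Or.inl (ne_of_gt (show (0 : ℝ) < t by linarith [ht.1]))
      · exact Real.continuousOn_log.mono fun t ht ↦ by simp only [Set.mem_compl_iff, Set.mem_singleton_iff]; linarith [ht.1]
      · intro t ht; exact (Real.log_pos (by linarith [ht.1])).ne'
    have hpow_int : ∀ a b : ℝ, 0 < a → a ≤ b → IntervalIntegrable (fun t : ℝ ↦ t ^ (-(1 / 2) : ℝ)) volume a b := by
      intro a b ha hab
      refine ContinuousOn.intervalIntegrable ?_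
      rw [Set.uIcc_of_le hab]
      exact ContinuousOn.rpow_const continuousOn_id fun t ht ↦ Or.inl (ne_of_gt (show (0 : ℝ) < t by linarith [ht.1]))
    rw [← intervalIntegral.integral_add_adjacent_intervals (hg_int 2 Y le_rfl hY2) (hg_int Y X hY2 hYX)]
    -- first piece: `≤ (1/log 2) ∫_2^Y t^{-1/2} = (2/log 2)(√Y − √2) ≤ (2/log 2) √Y`
    have hlog2 : 0 < Real.log 2 := Real.log_pos (by norm_num)
    have hlog2' : (0.69 : ℝ) < Real.log 2 := by linarith [Real.log_two_gt_d9]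
    have h1 : ∫ t in (2 : ℝ)..Y, t ^ (-(1 / 2) : ℝ) / Real.log t ≤ (2 / Real.log 2) * Real.sqrt Y := by
      calc ∫ t in (2 : ℝ)..Y, t ^ (-(1 / 2) : ℝ) / Real.log t
          ≤ ∫ t in (2 : ℝ)..Y, (1 / Real.log 2) * t ^ (-(1 / 2) : ℝ) := by
            refine intervalIntegral.integral_mono_on hY2 (hg_int 2 Y le_rfl hY2)
              ((hpow_int 2 Y (by norm_num) hY2).const_mul _) fun t ht ↦ ?_
            have ht0 : 0 < t := by linarith [ht.1]
            have hpos : 0 ≤ t ^ (-(1 / 2) : ℝ) := Real.rpow_nonneg ht0.le _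
            have hlt : (Real.log t)⁻¹ ≤ (Real.log 2)⁻¹ := inv_anti₀ hlog2 (Real.log_le_log (by norm_num) ht.1)
            calc t ^ (-(1 / 2) : ℝ) / Real.log t = t ^ (-(1 / 2) : ℝ) * (Real.log t)⁻¹ := div_eq_mul_inv _ _
              _ ≤ t ^ (-(1 / 2) : ℝ) * (Real.log 2)⁻¹ := mul_le_mul_of_nonneg_left hlt hpos
              _ = 1 / Real.log 2 * t ^ (-(1 / 2) : ℝ) := by ring
        _ = (1 / Real.log 2) * (2 * (Real.sqrt Y - Real.sqrt 2)) := by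
            rw [intervalIntegral.integral_const_mul, integral_rpow_neg_half 2 Y]
        _ = (2 / Real.log 2) * Real.sqrt Y - (2 / Real.log 2) * Real.sqrt 2 := by ring
        _ ≤ (2 / Real.log 2) * Real.sqrt Y := by
            have h' : 0 ≤ 2 / Real.log 2 * Real.sqrt 2 := by positivity
            linarith
    -- `√Y ≤ √2 · √(√X)` and `√(√X) log X ≤ 4 √X`
    have hsY : Real.sqrt Y * Real.log X ≤ Real.sqrt 2 * (4 * Real.sqrt X) := by
      have hY_le : Y ≤ 2 * Real.sqrt X := by
        rw [hY]; refine max_le ?_ ?_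
        · have : 1 ≤ Real.sqrt X := by rw [Real.le_sqrt (by norm_num) hX0.le]; linarith
          linarith
        · linarith [Real.sqrt_nonneg X]
      have h4 := sqrt_sqrt_mul_log_le hX1
      calc Real.sqrt Y * Real.log X ≤ Real.sqrt (2 * Real.sqrt X) * Real.log X := by
            gcongr
        _ = Real.sqrt 2 * (Real.sqrt (Real.sqrt X) * Real.log X) := by
            rw [Real.sqrt_mul (by norm_num)]; ring
        _ ≤ Real.sqrt 2 * (4 * Real.sqrt X) := by gcongr
    -- second piece: `≤ (2/log X) ∫_Y^X t^{-1/2} ≤ (2/log X) · 2 √X`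
    have h2 : ∫ t in Y..X, t ^ (-(1 / 2) : ℝ) / Real.log t ≤ (2 / Real.log X) * (2 * Real.sqrt X) := by
      have hY0 : 0 < Y := by linarith
      calc ∫ t in Y..X, t ^ (-(1 / 2) : ℝ) / Real.log t
          ≤ ∫ t in Y..X, (2 / Real.log X) * t ^ (-(1 / 2) : ℝ) := by
            refine intervalIntegral.integral_mono_on hYX (hg_int Y X hY2 hYX)
              ((hpow_int Y X hY0 hYX).const_mul _) fun t ht ↦ ?_
            have ht0 : 0 < t := by linarith [ht.1]
            have hpos : 0 ≤ t ^ (-(1 / 2) : ℝ) := Real.rpow_nonneg ht0.le _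
            have hsqX : Real.sqrt X ≤ t := le_trans (le_max_right _ _) ht.1
            have hlogt : Real.log X / 2 ≤ Real.log t := by
              rw [← Real.log_sqrt hX0.le]; exact Real.log_le_log hsX hsqX
            have hlogt0 : 0 < Real.log t := by linarith
            have hlt : (Real.log t)⁻¹ ≤ 2 / Real.log X := by
              have := inv_anti₀ (by positivity : 0 < Real.log X / 2) hlogt
              rwa [inv_div] at this
            calc t ^ (-(1 / 2) : ℝ) / Real.log t = t ^ (-(1 / 2) : ℝ) * (Real.log t)⁻¹ := div_eq_mul_inv _ _
              _ ≤ t ^ (-(1 / 2) : ℝ) * (2 / Real.log X) := mul_le_mul_of_nonneg_left hlt hpos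
              _ = 2 / Real.log X * t ^ (-(1 / 2) : ℝ) := by ring
        _ = (2 / Real.log X) * (2 * (Real.sqrt X - Real.sqrt Y)) := by
            rw [intervalIntegral.integral_const_mul, integral_rpow_neg_half Y X]
        _ = (2 / Real.log X) * (2 * Real.sqrt X) - (2 / Real.log X) * (2 * Real.sqrt Y) := by ring
        _ ≤ (2 / Real.log X) * (2 * Real.sqrt X) := by
            have h' : 0 ≤ 2 / Real.log X * (2 * Real.sqrt Y) := by positivity
            linarith
    have hs2 : Real.sqrt 2 < 1.42 := by
      rw [Real.sqrt_lt' (by norm_num)]; norm_num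
    -- combine: (2/log 2)√Y + 4√X/log X ≤ 22 √X/log X
    have hfirst : (2 / Real.log 2) * Real.sqrt Y ≤ 18 * Real.sqrt X / Real.log X := by
      rw [le_div_iff₀ hlogX]
      calc 2 / Real.log 2 * Real.sqrt Y * Real.log X = 2 / Real.log 2 * (Real.sqrt Y * Real.log X) := by ring
        _ ≤ 2 / Real.log 2 * (Real.sqrt 2 * (4 * Real.sqrt X)) := by gcongr
        _ ≤ 2 / 0.69 * (1.42 * (4 * Real.sqrt X)) := by
            gcongr
        _ ≤ 18 * Real.sqrt X := by nlinarith
    calc (∫ t in (2 : ℝ)..Y, t ^ (-(1 / 2) : ℝ) / Real.log t) + ∫ t in Y..X, t ^ (-(1 / 2) : ℝ) / Real.log t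
        ≤ 18 * Real.sqrt X / Real.log X + (2 / Real.log X) * (2 * Real.sqrt X) := by linarith
      _ = 22 * Real.sqrt X / Real.log X := by field_simp; ring
  -- assemble
  rw [← hLHS, habel]
  have := hint_le.trans hJ
  calc f X * ∑ k ∈ Finset.Icc 0 ⌊X⌋₊, c k - ∫ t in Set.Ioc 2 X, deriv f t * ∑ k ∈ Finset.Icc 0 ⌊t⌋₊, c k
      ≤ 5 * Real.sqrt X / Real.log X + (5 / 2) * (22 * Real.sqrt X / Real.log X) := by linarith
    _ = 60 * Real.sqrt X / Real.log X := by ring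

end Literature.NumberTheory.LFunctions
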